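import Summits.Ventures.PercRepro.C041TwoExitZone

/-!
# ROW C-041 — THE CYCLE HOST: reach on a cycle, and the statuses of a colouring by its arcs (p6, gen 31; towards
mine-3's arc-type model of the two-exit cycle, C-041.md §20 (d), §21 (a))

`cyc n` is the cycle `C_{n+1}` on the vertices `Fin (n+1)`, the edge `k` joining `k` and `k + 1` (the edge `n`
closes the cycle at `0`); no marks.  From a vertex `x` there are two paths to a vertex `z`: FORWARD through the
edges `x, x+1, …, z−1` (`fwdArc x z`, cyclically) and BACKWARD through `x−1, …, z` (`bwdArc x z`).  THE REACH
LEMMA (`mem_reach_cyc`): `z` is reached from `x` along the colour `c` iff one of the two arcs is entirely of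
colour `c` — the set of such `z` contains `x` and is closed under the `c`-adjacency (the four arc inclusions
`fwdArc_succ` … `bwdArc_pred`), and a monochromatic arc is a path (`mem_reach_of_fwd`, `mem_reach_of_bwd`, by
induction on the distance).  With the anchor `0` and exits `i < j` the cycle splits into the ARCS `A₁ = [0, i)`,
`A₂ = [i, j)`, `A₃ = [j, n]`, and the statuses of `C041TwoExitZone` read (`Mg_cyc_zero_iff` …): `x_i` is merged
iff `A₁` is blue or `A₂`, `A₃` are; reached iff `A₁` is red or `A₂`, `A₃` are; `x_j` alike with `A₁ ↔ A₃`; the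
two exits are blue-connected iff `A₂` is blue or `A₁`, `A₃` are — mine-3's table (C041CycleArcModel).  The
dictionary «the arc-type model is the cycle's six-vector» is the next module.
-/

namespace PercRepro

namespace ZoneZ

namespace TwoExit

open ZoneData Pendant

/-! ## Arcs on the cycle, as sets of edges (by value) -/

/-- The edges of the forward path from `x` to `z`: `x, x+1, …, z−1`, cyclically. -/
def fwdArc (x z k : ℕ) : Prop := if x ≤ z then x ≤ k ∧ k < z else x ≤ k ∨ k < z

/-- The edges of the backward path from `x` to `z`: `x−1, …, z`, cyclically. -/
def bwdArc (x z k : ℕ) : Prop := if x ≤ z then k < x ∨ z ≤ k else z ≤ k ∧ k < x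

/-- The length of the forward path. -/
def fwdDist (n x z : ℕ) : ℕ := if x ≤ z then z - x else z + (n + 1) - x

/-- The length of the backward path. -/
def bwdDist (n x z : ℕ) : ℕ := if z ≤ x then x - z else x + (n + 1) - z

/-- The forward arc from `x` to itself is empty. -/
theorem fwdArc_self (x k : ℕ) : ¬ fwdArc x x k := by
  unfold fwdArc
  simp

/-- The first edge of a non-trivial forward path. -/
theorem fwdArc_start {x z : ℕ} (h : x ≠ z) : fwdArc x z x := by
  unfold fwdArc
  split_ifs <;> omega

/-- The last edge of a non-trivial backward path, `x − 1` (cyclically, with `n` for `x = 0`). -/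
theorem bwdArc_start {n x z : ℕ} (_hx : x ≤ n) (hz : z ≤ n) (_h : x ≠ z) :
    bwdArc x z (if x = 0 then n else x - 1) := by
  by_cases hx0 : x = 0
  · rw [if_pos hx0]
    unfold bwdArc
    split_ifs <;> omega
  · rw [if_neg hx0]
    unfold bwdArc
    split_ifs <;> omega

/-- Stepping forward shortens the forward arc: the edges of the path from `x + 1` are edges of the path from
`x`. -/
theorem fwdArc_of_succ {n x z k : ℕ} (_hx : x ≤ n) (hz : z ≤ n) (_hk : k ≤ n) (h : x ≠ z)
    (hf : fwdArc (if x = n then 0 else x + 1) z k) : fwdArc x z k := by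
  by_cases hxn : x = n
  · rw [if_pos hxn] at hf
    unfold fwdArc at hf ⊢
    split_ifs at hf ⊢ <;> omega
  · rw [if_neg hxn] at hf
    unfold fwdArc at hf ⊢
    split_ifs at hf ⊢ <;> omega

/-- Stepping backward shortens the backward arc (the step not landing on `z`). -/
theorem bwdArc_of_pred {n x z k : ℕ} (_hx : x ≤ n) (hz : z ≤ n) (_hk : k ≤ n) (_h : x ≠ z)
    (h' : (if x = 0 then n else x - 1) ≠ z) (hb : bwdArc (if x = 0 then n else x - 1) z k) : bwdArc x z k := by
  by_cases hx0 : x = 0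
  · rw [if_pos hx0] at hb h'
    unfold bwdArc at hb ⊢
    split_ifs at hb ⊢ <;> omega
  · rw [if_neg hx0] at hb h'
    unfold bwdArc at hb ⊢
    split_ifs at hb ⊢ <;> omega

/-- The forward distance drops by one after a forward step. -/
theorem fwdDist_succ {n x z : ℕ} (hx : x ≤ n) (hz : z ≤ n) (h : x ≠ z) :
    fwdDist n (if x = n then 0 else x + 1) z + 1 = fwdDist n x z := by
  by_cases hxn : x = n
  · rw [if_pos hxn]
    unfold fwdDist
    split_ifs <;> omega
  · rw [if_neg hxn]
    unfold fwdDist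
    split_ifs <;> omega

/-- The backward distance drops by one after a backward step. -/
theorem bwdDist_pred {n x z : ℕ} (hx : x ≤ n) (hz : z ≤ n) (h : x ≠ z) :
    bwdDist n (if x = 0 then n else x - 1) z + 1 = bwdDist n x z := by
  by_cases hx0 : x = 0
  · rw [if_pos hx0]
    unfold bwdDist
    split_ifs <;> omega
  · rw [if_neg hx0]
    unfold bwdDist
    split_ifs <;> omega

/-- A forward step from `z` (to `z + 1 ≠ x`) adds the edge `z` to the forward arc from `x`. -/
theorem fwdArc_succ {n x z k : ℕ} (hx : x ≤ n) (_hz : z ≤ n) (hk : k ≤ n) (_hzx : z ≠ x)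
    (_hz'x : (if z = n then 0 else z + 1) ≠ x) (hf : fwdArc x (if z = n then 0 else z + 1) k) :
    fwdArc x z k ∨ k = z := by
  by_cases hzn : z = n
  · rw [if_pos hzn] at hf
    unfold fwdArc at hf ⊢
    split_ifs at hf ⊢ <;> omega
  · rw [if_neg hzn] at hf
    unfold fwdArc at hf ⊢
    split_ifs at hf ⊢ <;> omega

/-- A forward step from `z` (to `z + 1 ≠ x`) removes the edge `z` from the backward arc from `x`. -/
theorem bwdArc_succ {n x z k : ℕ} (hx : x ≤ n) (_hz : z ≤ n) (_hk : k ≤ n) (_hzx : z ≠ x)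
    (hz'x : (if z = n then 0 else z + 1) ≠ x) (hb : bwdArc x (if z = n then 0 else z + 1) k) :
    bwdArc x z k := by
  by_cases hzn : z = n
  · rw [if_pos hzn] at hz'x hb
    unfold bwdArc at hb ⊢
    split_ifs at hb ⊢ <;> omega
  · rw [if_neg hzn] at hz'x hb
    unfold bwdArc at hb ⊢
    split_ifs at hb ⊢ <;> omega

/-- A backward step from `z` (to `z − 1 ≠ x`) removes the edge `z − 1` from the forward arc from `x`. -/
theorem fwdArc_pred {n x z k : ℕ} (hx : x ≤ n) (_hz : z ≤ n) (_hk : k ≤ n) (hzx : z ≠ x)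
    (hz'x : (if z = 0 then n else z - 1) ≠ x) (hf : fwdArc x (if z = 0 then n else z - 1) k) :
    fwdArc x z k := by
  by_cases hz0 : z = 0
  · rw [if_pos hz0] at hz'x hf
    unfold fwdArc at hf ⊢
    split_ifs at hf ⊢ <;> omega
  · rw [if_neg hz0] at hz'x hf
    unfold fwdArc at hf ⊢
    split_ifs at hf ⊢ <;> omega

/-- A backward step from `z` (to `z − 1 ≠ x`) adds the edge `z − 1` to the backward arc from `x`. -/
theorem bwdArc_pred {n x z k : ℕ} (hx : x ≤ n) (_hz : z ≤ n) (hk : k ≤ n) (_hzx : z ≠ x)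
    (_hz'x : (if z = 0 then n else z - 1) ≠ x) (hb : bwdArc x (if z = 0 then n else z - 1) k) :
    bwdArc x z k ∨ k = (if z = 0 then n else z - 1) := by
  by_cases hz0 : z = 0
  · rw [if_pos hz0] at hb ⊢
    unfold bwdArc at hb ⊢
    split_ifs at hb ⊢ <;> omega
  · rw [if_neg hz0] at hb ⊢
    unfold bwdArc at hb ⊢
    split_ifs at hb ⊢ <;> omega

/-- The forward arc from `x` to its successor `x + 1 ≠ x` is the single edge `x`. -/
theorem fwdArc_succ_self {n x k : ℕ} (_hx : x ≤ n) (hk : k ≤ n) (_hn : (if x = n then 0 else x + 1) ≠ x)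
    (hf : fwdArc x (if x = n then 0 else x + 1) k) : k = x := by
  by_cases hxn : x = n
  · rw [if_pos hxn] at hf
    unfold fwdArc at hf
    split_ifs at hf <;> omega
  · rw [if_neg hxn] at hf
    unfold fwdArc at hf
    split_ifs at hf <;> omega

/-- The backward arc from `x` to its predecessor `x − 1 ≠ x` is the single edge `x − 1`. -/
theorem bwdArc_pred_self {n x k : ℕ} (hx : x ≤ n) (hk : k ≤ n) (_hn : (if x = 0 then n else x - 1) ≠ x)
    (hb : bwdArc x (if x = 0 then n else x - 1) k) : k = (if x = 0 then n else x - 1) := by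
  by_cases hx0 : x = 0
  · rw [if_pos hx0] at hb ⊢
    unfold bwdArc at hb
    split_ifs at hb
    all_goals omega
  · rw [if_neg hx0] at hb ⊢
    unfold bwdArc at hb
    split_ifs at hb
    all_goals omega

/-! ## The cycle host -/

variable (n : ℕ)

/-- THE CYCLE HOST `C_{n+1}`: vertices and edges `Fin (n+1)`, the edge `k` joining `k` and `k + 1`; no marks. -/
def cyc : ZoneData (Fin (n + 1)) (Fin (n + 1)) Empty Empty where
  fst := id
  snd := fun k => k + 1
  at₁ := Empty.elim
  at₂ := Empty.elim

/-- The incidences of the cycle. -/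
theorem cyc_joins_iff (e x y : Fin (n + 1)) :
    (cyc n).Joins e x y ↔ (e = x ∧ e + 1 = y) ∨ (e = y ∧ e + 1 = x) := Iff.rfl

variable (c : Bool) (ω : Fin (n + 1) → Bool)

/-- The value of the successor, as an `if`. -/
theorem val_succ (y : Fin (n + 1)) : (y + 1).val = if y.val = n then 0 else y.val + 1 := by
  rw [Fin.val_add_one]
  by_cases h : y = Fin.last n
  · rw [if_pos h, if_pos (by rw [h, Fin.val_last])]
  · rw [if_neg h, if_neg (fun h' => h (Fin.ext (by rw [h', Fin.val_last])))]

/-- The value of the predecessor, as an `if`. -/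
theorem val_pred (y : Fin (n + 1)) : (y - 1).val = if y.val = 0 then n else y.val - 1 := by
  rw [Fin.coe_sub_one]
  by_cases h : y = 0
  · rw [if_pos h, if_pos (by rw [h, Fin.val_zero])]
  · rw [if_neg h, if_neg (fun h' => h (Fin.ext (by rw [h', Fin.val_zero])))]

/-- A forward step along an edge of colour `c`. -/
theorem mem_reach_succ {x y : Fin (n + 1)} (hy : y ∈ reach (cAdj (cyc n) c ω) {x}) (hc : ω y = c) :
    y + 1 ∈ reach (cAdj (cyc n) c ω) {x} :=
  reach_tail hy ⟨y, Or.inl ⟨rfl, rfl⟩, hc⟩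

/-- A backward step along an edge of colour `c`. -/
theorem mem_reach_pred {x y : Fin (n + 1)} (hy : y ∈ reach (cAdj (cyc n) c ω) {x}) (hc : ω (y - 1) = c) :
    y - 1 ∈ reach (cAdj (cyc n) c ω) {x} :=
  reach_tail hy ⟨y - 1, Or.inr ⟨rfl, sub_add_cancel y 1⟩, hc⟩

/-- **A monochromatic forward arc is a path**: if every edge of the forward arc from `y` to `z` has colour `c`,
then `z` is reached from `y`. -/
theorem mem_reach_of_fwd (t : ℕ) : ∀ y z : Fin (n + 1), fwdDist n y.val z.val = t →
    (∀ k : Fin (n + 1), fwdArc y.val z.val k.val → ω k = c) → z ∈ reach (cAdj (cyc n) c ω) {y} := by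
  induction t with
  | zero =>
    intro y z ht _
    have : y = z := by
      unfold fwdDist at ht
      split_ifs at ht <;> exact Fin.ext (by omega)
    rw [this]
    exact mem_reach_of_mem rfl
  | succ t ih =>
    intro y z ht hf
    have hyz : y.val ≠ z.val := by
      intro h
      unfold fwdDist at ht
      split_ifs at ht <;> omega
    have hstep := mem_reach_succ n c ω (mem_reach_of_mem (R := cAdj (cyc n) c ω) (S := {y}) rfl)
      (hf y (fwdArc_start hyz))
    have hv := val_succ n y
    have hz : z ∈ reach (cAdj (cyc n) c ω) {y + 1} := by
      refine ih (y + 1) z ?_ ?_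
      · rw [hv]
        have := fwdDist_succ (n := n) y.is_le z.is_le hyz
        omega
      · intro k hk
        rw [hv] at hk
        exact hf k (fwdArc_of_succ y.is_le z.is_le k.is_le hyz hk)
    exact mem_reach_singleton_trans hz hstep

/-- **A monochromatic backward arc is a path.** -/
theorem mem_reach_of_bwd (t : ℕ) : ∀ y z : Fin (n + 1), bwdDist n y.val z.val = t →
    (∀ k : Fin (n + 1), bwdArc y.val z.val k.val → ω k = c) → z ∈ reach (cAdj (cyc n) c ω) {y} := by
  induction t with
  | zero =>
    intro y z ht _
    have : y = z := by
      unfold bwdDist at ht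
      split_ifs at ht <;> exact Fin.ext (by omega)
    rw [this]
    exact mem_reach_of_mem rfl
  | succ t ih =>
    intro y z ht hb
    have hyz : y.val ≠ z.val := by
      intro h
      unfold bwdDist at ht
      split_ifs at ht <;> omega
    have hv := val_pred n y
    have hstep := mem_reach_pred n c ω (mem_reach_of_mem (R := cAdj (cyc n) c ω) (S := {y}) rfl)
      (hb (y - 1) (by rw [hv]; exact bwdArc_start y.is_le z.is_le hyz))
    by_cases hy1 : y - 1 = z
    · rw [← hy1]
      exact hstep
    have hy1' : (if y.val = 0 then n else y.val - 1) ≠ z.val := by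
      rw [← hv]
      exact fun h => hy1 (Fin.ext h)
    have hz : z ∈ reach (cAdj (cyc n) c ω) {y - 1} := by
      refine ih (y - 1) z ?_ ?_
      · rw [hv]
        have := bwdDist_pred (n := n) y.is_le z.is_le hyz
        omega
      · intro k hk
        rw [hv] at hk
        exact hb k (bwdArc_of_pred y.is_le z.is_le k.is_le hyz hy1' hk)
    exact mem_reach_singleton_trans hz hstep

/-- **THE REACH LEMMA OF THE CYCLE**: `z` is reached from `x` along the colour `c` iff the forward arc or the
backward arc from `x` to `z` is entirely of colour `c`. -/
theorem mem_reach_cyc (x z : Fin (n + 1)) :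
    z ∈ reach (cAdj (cyc n) c ω) {x} ↔
      (∀ k : Fin (n + 1), fwdArc x.val z.val k.val → ω k = c) ∨
        (∀ k : Fin (n + 1), bwdArc x.val z.val k.val → ω k = c) := by
  constructor
  · intro h
    have key : reach (cAdj (cyc n) c ω) {x} ⊆ {z | (∀ k : Fin (n + 1), fwdArc x.val z.val k.val → ω k = c) ∨
        (∀ k : Fin (n + 1), bwdArc x.val z.val k.val → ω k = c)} := by
      refine reach_subset_of_closed ?_ ?_
      · intro w hw
        rw [Set.mem_singleton_iff] at hw
        rw [hw]
        exact Or.inl fun k hk => absurd hk (fwdArc_self _ _)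
      · rintro w w' hw ⟨e, he, hc⟩
        rw [cyc_joins_iff] at he
        show (∀ k : Fin (n + 1), fwdArc x.val w'.val k.val → ω k = c) ∨
          (∀ k : Fin (n + 1), bwdArc x.val w'.val k.val → ω k = c)
        by_cases hw'x : w' = x
        · rw [hw'x]
          exact Or.inl fun k hk => absurd hk (fwdArc_self _ _)
        have hw'x' : w'.val ≠ x.val := fun h => hw'x (Fin.ext h)
        rcases he with ⟨rfl, rfl⟩ | ⟨rfl, rfl⟩
        · -- forward step from `w = e` to `e + 1`
          have hv := val_succ n e
          by_cases hex : e = x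
          · subst hex
            refine Or.inl fun k hk => ?_
            rw [hv] at hk
            have := fwdArc_succ_self (n := n) e.is_le k.is_le (by rw [← hv]; exact hw'x') hk
            rw [Fin.ext this]
            exact hc
          have hex' : e.val ≠ x.val := fun h => hex (Fin.ext h)
          rcases hw with hw | hw
          · refine Or.inl fun k hk => ?_
            rw [hv] at hk
            rcases fwdArc_succ (n := n) x.is_le e.is_le k.is_le hex' (by rw [← hv]; exact hw'x') hk with h1 | h1
            · exact hw k h1
            · rw [Fin.ext h1]
              exact hc
          · refine Or.inr fun k hk => ?_
            rw [hv] at hk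
            exact hw k (bwdArc_succ (n := n) x.is_le e.is_le k.is_le hex' (by rw [← hv]; exact hw'x') hk)
        · -- backward step from `w = e + 1` to `e`
          have hv : e.val = if (e + 1).val = 0 then n else (e + 1).val - 1 := by
            have := val_pred n (e + 1)
            rw [add_sub_cancel_right] at this
            exact this
          by_cases hex : e + 1 = x
          · rw [hex] at hv
            refine Or.inr fun k hk => ?_
            rw [hv] at hk
            have := bwdArc_pred_self (n := n) x.is_le k.is_le (by rw [← hv]; exact hw'x') hk
            rw [Fin.ext (this.trans hv.symm)]
            exact hc
          have hex' : (e + 1).val ≠ x.val := fun h => hex (Fin.ext h)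
          rcases hw with hw | hw
          · refine Or.inl fun k hk => ?_
            rw [hv] at hk
            exact hw k (fwdArc_pred (n := n) x.is_le (e + 1).is_le k.is_le hex' (by rw [← hv]; exact hw'x') hk)
          · refine Or.inr fun k hk => ?_
            rw [hv] at hk
            rcases bwdArc_pred (n := n) x.is_le (e + 1).is_le k.is_le hex' (by rw [← hv]; exact hw'x') hk with
              h1 | h1
            · exact hw k h1
            · rw [Fin.ext (h1.trans hv.symm)]
              exact hc
    exact key h
  · rintro (h | h)
    · exact mem_reach_of_fwd n c ω _ x z rfl h
    · exact mem_reach_of_bwd n c ω _ x z rfl h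

end TwoExit

end ZoneZ

end PercRepro
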